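/-
Copyright (c) 2026 the pub-hodgecm-mathlib formalisation cell (harness21).  Prover seat hodgecm-mathlib-F0P3a-p01 (g39), lane A (Unr-K, type U) of the (β₂) road, squad
F0∕P3a ∕ F0∕P3c∕LH4; β₂ WORD #42 leaf ‹LINE-L-A-MIX-HI›: the three-way literal reads (hL₁)(hL₂) of the count socket ★ p864098 for a LOWER-LINE cell at `d ≤ b` ON TYPE U —
LH7-p09 (g3)'s ★ `…LowerLineCellLiteralReads.reads_of_gen6_lowerLine` with `hDM ↦ hDMρ` (sharp transfer ★ S1) and `g2 ↦ g2b, g2c` (M3), 2026-09-05.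
-/
import Summits.HodgeConjecture.HodgeConjecture.Theorems.F0P3cDyRamUpperRayCellReads                 -- ★ p864444 (LH4-p19 (g3), R1b-A): `exists_vertexFrame_of_gen`, `weight_ne_zero_iff_normSign_of_gen6` (cell-generic); brings ★ p862869, ★ p864081
import Summits.HodgeConjecture.HodgeConjecture.Theorems.F0P3cDyRamLowerLineVertexReadsA               -- (this seat, M3): `valueSet_eq_xPlus_iff_sphereSign_of_line_A`; brings ★ p864441 `sphere_of_line` (the lower-line vertex reads)
import Summits.HodgeConjecture.HodgeConjecture.Theorems.F0P3cDyRamRowCellGeneratorIndependenceSharpA -- ★ p865350 (this seat, S1): `v_coord_sub_coord_mul_le_sharpA_of_gen` (the sharp (hI) digit part from the Θρ-datum)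
import HarnessLib

/-!
# Crux `H413`, line LH4 «(D-RAM) FOUR-FRAME» — STAGE-1b, row (2), the (β₂) road (R-36), (OFF) residue, LOWER line at `d ≤ b`, LANE A (Unr-K, type U): «THE LITERAL READS OF A
# LOWER-LINE CELL, Θρ-DATUM AND NO `|Θα − α|`» (★ `reads_of_gen6_lowerLine` with `hDM ↦ hDMρ`, `g2 ↦ g2b g2c hU hτ`; proof token for token, M3∕S1 for ★ p864441∕★ p864599) — for a
# populated member `(Λ, x₀)` the two literal predicates «∃ glued `L₃` with `VS_{m⋆} = VS(X₊)`» ∕ «… `≠`» (the shell conjunct already folded by ★ p863399) are the sphere digit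
# `|γ₁(V − W₁)| = 1` (AUTOMATIC on the lower line, ★ p864441 §1) together with the sign `ω(γ₁(V − W₁)) = ω(−h_W)` ∕ `≠`, `V = V(x₀)` — the hypotheses (hL₁)(hL₂) of
# ★ p864098 `cellDiff_eq_zero_of_fibration_reads₄`

Cell `hodgecm-mathlib` (D-0151), FLOOR 0, crux item H413 = `stmt-HodgeConjecture-24833`, route of record `HCCMUnconditional`; squads F0∕P3a ∕ F0∕P3c∕LH4 ∕ LH7; lane
`--supports stmt-HodgeConjecture-24833 --as helper` (count-neutral; pays NO tier-0 row).  THEOREMS ONLY (no `def`, no instance, no notation, no `sorry`, default heartbeats);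
★-only imports; states NO law; (β₂) stays a HYPOTHESIS.  Frame = ★ R1b-B's (the opened letters of ‹OFF.letter.v2› used by the pieces, `E` complete with finite residue field,
the Θρ-datum `hDMρ : IsRamifiedQuadraticDatum (Θ.comp ρ) (jE ϖ) d tM` — lane A, ★ p864975) + the cell `(j, b)` on the LOWER line (`1 ≤ b`, `d ≤ b`, `b < j`, `IsOrd(lam)`) + the CELL-LEVEL letters of the R2 worker: the class letter `hFgap`;
reference pair `κ₀, ξ₀` (`|κ₀| ≤ |ξ₀|`, `|ϖE|^b ≤ |ξ₀|·|cc(α − ρα)|`); centre `W`, slope `BE`, `P = (ϖσϖ)^b`, fixed `γ₁, W₁` with the SLOPE∕ROOT letters; the SHARP digit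
transfer letter `hγr : |γ₁|·|ϖ|^{2b+d−1} ≤ |ϖ|^{2d−1}·|ξ₀|·|cc(α − ρα)|` (reads `d ≤ b` at `|γ₁| = |cc(α − ρα)|·|ξ₀|·|ϖ|^{−b}`); the lower-line sizes `hμle hanti g1 g2 g3 gsk`
(★ p864493 `lowerLine_sizeLetters_of_le`) at `n ≥ 3d − 2 + d%2`, the deep tokens `hΘlam hvlam huu hlamn hun`, and `ρμ ≠ μ`.

WHY (β₂ sub-dealer LH4-p04 (g10) 02:08:26Z (b) «road A = LH4-p19 (g3)'s R2 worker with `hdb : d ≤ b`»).  The socket reads each literal three-way: `P₁ Λ ↔ ∃ Ve, jE Ve = Vf x₀ ∧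
NX Ve ∧ ψ Ve` for EVERY generator `x₀` of a populated member.  A glued `L₃` over `Λ` comes with ITS OWN presentation generator `x₁` (★ p862869), at which ★ p864441 reads the
sphere `|γ₁(V₁ − W₁)| = 1` (§1, no hypothesis) and the label `VS = VS(X₊) ↔ ω(⟨w₁,w₁⟩·P)·ω(γ₁(V₁ − W₁)) = 1` (§2), with `ω(⟨w₁,w₁⟩·P) = ω(−h_W)` on the populated member
(★ R1b-A §3); ★ p864599's SHARP generator independence moves `V₁` to `V = V(x₀)`: `|γ₁(V₁ − V)| ≤ |γ₁|·|ϖ|^{2b+d−1}∕(|ξ₀|·|cc(α − ρα)|) ≤ |ϖ|^{2d−1}` (`hγr`), under which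
sphere and sign are constant (★ Lit `normSign_eq_of_near` at the conductor digit); the converse direction takes the glued vertex of ★ p864081.
* HEAD `reads_of_gen6_lowerLine_A` — both iff's at once, for the six-clause `GEN` of ★ p864098 and `f b j Λ ≠ 0`, literal bodies = ★ p863399's folded sets at
  `P L₃ := (VS_{m⋆}(L₃) = valueSetMod σ ϖ m⋆ X₊)` resp. `¬ (…)`.
HONEST LABEL.  Count-neutral bookkeeping; nothing printed is asserted; no census law is stated; ‹LINE-L-A-MIX-HI› stays OPEN; `HC_CM` is proved only modulo the
7 printed citations (2 remaining named inputs: hLiu418 = `stmt-HodgeConjecture-24832`, h413 = `stmt-HodgeConjecture-24833`) until rung 0 closes.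
## References
* [Kottwitz1986BaseChangeUnits] R. E. Kottwitz, *Base change for unit elements of Hecke algebras*, Compositio Math. 60 (1986): §1 pp. 240–241, §3.
* [Jacobowitz1962] R. Jacobowitz, *Hermitian forms over local fields*, Amer. J. Math. 84 (1962): §4.
* [Rogawski1990] J. D. Rogawski, *Automorphic Representations of Unitary Groups in Three Variables*, Ann. of Math. Stud. 123 (1990): §4.9 Prop. 4.9.1 (b) p. 55, §12.2.
* [Serre1979] J.-P. Serre, *Local Fields*, GTM 67 (1979): Ch. III §3 Prop. 7, §6 Prop. 12; Ch. V §3 Cor. 3; Ch. XV §2.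
-/

set_option autoImplicit false

noncomputable section

namespace Summit.HodgeConjecture.HodgeConjecture.Cruxes.H413.F0P3cDyRamLowerLineCellLiteralReadsA

open scoped Valued WithZero Matrix MatrixGroups
open WithZero
open Literature.NumberTheory.Automorphic Literature.NumberTheory.Automorphic.HermitianLattice Literature.NumberTheory.Automorphic.UnitaryLatticeTree
open Literature.NumberTheory.Automorphic.UnitaryThreeFourFrame (IsRamifiedQuadraticDatum normSign)
open Literature.NumberTheory.Rogawski1990
open Literature.NumberTheory.LocalFields.WildQuadraticDatum (normSign_eq_of_near)
open Summit.HodgeConjecture.HodgeConjecture.Cruxes.H413.F0P3cDyRamFourFramePieces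
open Summit.HodgeConjecture.HodgeConjecture.Cruxes.H413.F0P3cDyRamFourFrameCensusDefs (LatticeInLevel)
open Summit.HodgeConjecture.HodgeConjecture.Cruxes.H413.F0P3cDyRamToricCensusDefs
open Summit.HodgeConjecture.HodgeConjecture.Cruxes.H413.F0P3cDyRamLabelShellFlipCardTwo (v_refSkew_eq)
open Summit.HodgeConjecture.HodgeConjecture.Cruxes.H413.F0P3cDyRamConeCellPresentation (exists_presentation_of_mem_levelSetDep)
open Summit.HodgeConjecture.HodgeConjecture.Cruxes.H413.F0P3cDyRamConeCellGluedVertexExistsOfWeight (exists_glued_of_mem_levelSetDep_of_weight_ne_zero)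
open Summit.HodgeConjecture.HodgeConjecture.Cruxes.H413.F0P3cDyRamRowCellGeneratorIndependenceSharpA (v_coord_sub_coord_mul_le_sharpA_of_gen)
open Summit.HodgeConjecture.HodgeConjecture.Cruxes.H413.F0P3cDyRamRowVertexPopulationRead (normSign_mul_eq_one_iff_eq)
open Summit.HodgeConjecture.HodgeConjecture.Cruxes.H413.F0P3cDyRamLowerLineVertexReads (sphere_of_line)
open Summit.HodgeConjecture.HodgeConjecture.Cruxes.H413.F0P3cDyRamLowerLineVertexReadsA (valueSet_eq_xPlus_iff_sphereSign_of_line_A)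
open Summit.HodgeConjecture.HodgeConjecture.Cruxes.H413.F0P3cDyRamUpperRayCellReads (exists_vertexFrame_of_gen weight_ne_zero_iff_normSign_of_gen6)

variable {E M : Type} [Field E] [Valued E ℤᵐ⁰] [Field M] [Valued M ℤᵐ⁰] {ρ Θ : M →+* M} {α : M}

/-- **HEAD — «THE LITERAL READS OF A POPULATED MEMBER OF A LOWER-LINE CELL».**  Opened ‹OFF-A.letter.v2› letters (E-datum with `E` complete, the Θρ-datum `hDMρ`, type-U `hU hτ`, sizes `g2 ↦ g2b g2c`,
`jE`-letters, the line model, the literal `(H₂, h_W)`, the element `(γ₂, u)`, the weight letter `hf`) + the cell `(j, b)` on the LOWER line (`1 ≤ b`, `d ≤ b`, `b < j`,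
`IsOrd(lam)`) + the CELL-LEVEL letters: the class letter `hFgap`; reference pair `κ₀, ξ₀` (`|κ₀| ≤ |ξ₀|`, `|ϖE|^b ≤ |ξ₀|·|cc(α − ρα)|`); centre `W`, slope `BE`, `P = (ϖσϖ)^b`
(`σP = P ≠ 0`), fixed `γ₁, W₁` with the SLOPE∕ROOT letters; the SHARP digit transfer `|γ₁|·|ϖ|^{2b+d−1} ≤ |ϖ|^{2d−1}·|ξ₀|·|cc(α − ρα)|`; the lower-line sizes
`|μ| ≤ |ϖE|^{2b+ℓ₀+1}`, `|μ − ρμ| = |cc(α − ρα)|·|ϖE|^{b+ℓ₀}`, `g1 g2 g3` at `m⋆` and `gsk` at `n ≥ 3d − 2 + d%2` (★ p864493); the deep tokens; `ρμ ≠ μ`.  THEN for every member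
`(Λ, x₀)` with the six `GEN` clauses and `f b j Λ ≠ 0`:
`(∃ B, φ(B) = Λ ∧ ∃ L₃, SD ∧ L₃ ∩ W = ι_W B ∧ tube_b ∧ VS_{m⋆}(L₃) = VS(X₊)) ↔ ∃ Ve, jE Ve = Vf x₀ ∧ |γ₁(Ve − W₁)| = 1 ∧ ψ Ve`, and the same with `¬ (VS = VS(X₊))` ∕
`¬ ψ Ve`, where `Vf x₀ = (ρu₀∕t − κ₀)∕ξ₀`, `ψ Ve :≡ |γ₁(Ve − W₁)| = 1 → ω(γ₁(Ve − W₁)) = ω(−h_W)` — the literal bodies are ★ p863399's FOLDED sets (no shell conjunct).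
[cite: Kottwitz1986BaseChangeUnits, §1 pp. 240–241] [cite: Jacobowitz1962, §4] [cite: Rogawski1990, §4.9 Prop. 4.9.1 (b) p. 55] [cite: Serre1979, Ch. III §3 Prop. 7; Ch. V §3 Cor. 3; Ch. XV §2] -/
theorem reads_of_gen6_lowerLine_A [CompleteSpace E] [IsDiscreteValuationRing 𝒪[E]] [Finite 𝓀[E]]
    {σ : E →+* E} {ϖ : E} {d tE : ℕ} (hD : IsRamifiedQuadraticDatum σ ϖ d tE) (h2v : Valued.v (2 : E) < 1)
    (jE : E →+* M) (hjiso : ∀ a, Valued.v (jE a) = Valued.v a) (hjfix : ∀ z, ρ z = z ↔ ∃ c, jE c = z) (hΘj : ∀ c, Θ (jE c) = jE (σ c))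
    (hjpow : ∀ (t : E) (n : ℤ), Valued.v (jE t) = Valued.v (jE ϖ) ^ n ↔ Valued.v t = Valued.v ϖ ^ n)
    (hϖmax : ∀ t : M, ρ t = t → Valued.v t < 1 → Valued.v t ≤ Valued.v (jE ϖ))
    (hρρ : ∀ x, ρ (ρ x) = x) (hvρ : ∀ x, Valued.v (ρ x) = Valued.v x) (hα : ρ α ≠ α) (hα1 : Valued.v α ≤ 1)
    (hint : ∀ z : M, Valued.v z ≤ 1 → Valued.v ((z - ρ z) / (α - ρ α)) ≤ 1)
    (hΘΘ : ∀ x, Θ (Θ x) = x) (hΘρ : ∀ x, Θ (ρ x) = ρ (Θ x)) (hvΘ : ∀ x, Valued.v (Θ x) = Valued.v x)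
    {tM : ℕ} (hDMρ : IsRamifiedQuadraticDatum (Θ.comp ρ) (jE ϖ) d tM)
    {hM : M} (hΘh : Θ hM = hM) (hh : hM ≠ 0)
    {H₂ : Matrix (Fin 2) (Fin 2) E} (hH₂ : IsUnit H₂.det) (hH₂σ : (H₂.map σ)ᵀ = H₂) {hW : E} (hhW : Valued.v hW = 1) (hhWσ : σ hW = hW)
    (φ : (Fin 2 → E) →+ M) (hφs : ∀ (c : E) (x : Fin 2 → E), φ (c • x) = jE c * φ x) (hφi : Function.Injective φ) (hφo : Function.Surjective φ)
    {γ₂ : GL (Fin 2) E} {lam : M} (hφγ : ∀ x, φ ((γ₂ : Matrix (Fin 2) (Fin 2) E).mulVec x) = lam * φ x) (hvlam : Valued.v lam = 1) (hΘlam : Θ lam * lam = 1)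
    (hform : ∀ x y, jE (pairing σ H₂ x y) = hM * Θ (φ x) * φ y + ρ (hM * Θ (φ x) * φ y))
    (u : GL (Fin 1) E) (huu : ((u : Matrix (Fin 1) (Fin 1) E) 0 0) * σ ((u : Matrix (Fin 1) (Fin 1) E) 0 0) = 1)
    {j b : ℕ} (hb1 : 1 ≤ b) (hdb : d ≤ b) (hbj : b < j) (hcc : jE ϖ ^ j * (α - ρ α) ≠ 0) (hlamj : IsOrd ρ α (jE ϖ ^ j) lam)
    (f : ℕ → ℕ → AddSubgroup M → ℕ)
    (hf : ∀ (b j : ℕ) (Λ : AddSubgroup M) (x₀ : M) (r : E), 1 ≤ b → x₀ ≠ 0 →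
      (∀ x, x ∈ Λ ↔ ∃ z, IsOrd ρ α (jE ϖ ^ j) z ∧ x = x₀ * z) →
      IsOrd ρ α (jE ϖ ^ j) (dualGen ρ Θ α (jE ϖ ^ j) hM x₀) → ¬ IsOrd ρ α (jE ϖ ^ j) (dualGen ρ Θ α (jE ϖ ^ j) hM x₀ / jE ϖ) →
      Valued.v (dualGen ρ Θ α (jE ϖ ^ j) hM x₀) = Valued.v (jE ϖ) ^ b →
      (∀ b', (∀ x ∈ Λ, Valued.v (hM * Θ x * b' + ρ (hM * Θ x * b')) ≤ 1) → (lam - jE ((u : Matrix (Fin 1) (Fin 1) E) 0 0)) * b' ∈ Λ) →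
      IsOrd ρ α (jE ϖ ^ j) lam → jE r = glueUnit ρ Θ α (jE ϖ ^ j) hM (jE ϖ) (jE hW) x₀ b →
      f b j Λ = Nat.card {x : 𝒪[E] ⧸ 𝓂[E] ^ (2 * b) // ∃ u' : 𝒪[E], Ideal.Quotient.mk (𝓂[E] ^ (2 * b)) u' = x ∧
        Valued.v ((u' : E) * σ u' - r) ≤ Valued.v (ϖ ^ (2 * b))})
    -- cell-level letters
    (hFgap : ∀ z : M, ρ z = z → Θ z = z → Valued.v (jE ϖ) < Valued.v z → Valued.v z ≤ 1 → Valued.v z = 1)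
    {κ₀ ξ₀ : M} (hκ₀ : κ₀ + ρ κ₀ = 1) (hΘκ₀ : Θ κ₀ = κ₀) (hξ : ρ ξ₀ = -ξ₀) (hΘξ : Θ ξ₀ = ξ₀) (hξ0 : ξ₀ ≠ 0)
    (hκ₀v : Valued.v κ₀ ≤ Valued.v ξ₀) (hR : Valued.v (jE ϖ) ^ b ≤ Valued.v ξ₀ * Valued.v (jE ϖ ^ j * (α - ρ α)))
    {W BE P γ₁ W₁ : E}
    (hWc : jE W * ξ₀ = ρ (lam - jE ((u : Matrix (Fin 1) (Fin 1) E) 0 0)) / (ρ (lam - jE ((u : Matrix (Fin 1) (Fin 1) E) 0 0)) - (lam - jE ((u : Matrix (Fin 1) (Fin 1) E) 0 0))) - κ₀)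
    (hBE : jE BE = ((lam - jE ((u : Matrix (Fin 1) (Fin 1) E) 0 0)) - ρ (lam - jE ((u : Matrix (Fin 1) (Fin 1) E) 0 0))) * ξ₀)
    (hP0 : P ≠ 0) (hσP : σ P = P) (hPb : P = (ϖ * σ ϖ) ^ b) (hσγ : σ γ₁ = γ₁) (hσW₁ : σ W₁ = W₁)
    (hθ : Valued.v (BE / (P * ((ϖ - σ ϖ) * ((ϖ * σ ϖ) ^ ((d - d % 2) / 2))⁻¹)) - γ₁) ≤ Valued.v γ₁ * Valued.v ϖ ^ (2 * d - 1))
    (hWW : Valued.v (γ₁ * (W - W₁)) ≤ Valued.v ϖ ^ (2 * d - 1))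
    (hγr : Valued.v γ₁ * Valued.v ϖ ^ (2 * b + d - 1) ≤ Valued.v ϖ ^ (2 * d - 1) * (Valued.v ξ₀ * Valued.v (jE ϖ ^ j * (α - ρ α))))
    -- the lower-line sizes (★ p864493 `lowerLine_sizeLetters_of_le`) and the deep tokens
    (hμle : Valued.v (lam - jE ((u : Matrix (Fin 1) (Fin 1) E) 0 0)) ≤ Valued.v (jE ϖ) ^ (2 * b + d % 2 + 1))
    (hanti : Valued.v ((lam - jE ((u : Matrix (Fin 1) (Fin 1) E) 0 0)) - ρ (lam - jE ((u : Matrix (Fin 1) (Fin 1) E) 0 0))) =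
      Valued.v (jE ϖ ^ j * (α - ρ α)) * Valued.v (jE ϖ) ^ (b + d % 2))
    (g1 : Valued.v (lam - jE ((u : Matrix (Fin 1) (Fin 1) E) 0 0)) * Valued.v (jE ϖ) ^ (d - 1) ≤
      Valued.v (α - ρ α) * Valued.v (jE ϖ) ^ b * Valued.v (jE ϖ) ^ mstarOfRecord d)
    (g2b : Valued.v (lam - jE ((u : Matrix (Fin 1) (Fin 1) E) 0 0)) * Valued.v (jE ϖ ^ j) ≤
      Valued.v (jE ϖ) ^ b * Valued.v (jE ϖ) ^ b * Valued.v (jE ϖ) ^ mstarOfRecord d)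
    (g2c : Valued.v ((lam - jE ((u : Matrix (Fin 1) (Fin 1) E) 0 0)) - ρ (lam - jE ((u : Matrix (Fin 1) (Fin 1) E) 0 0))) ≤
      Valued.v (α - ρ α) * Valued.v (jE ϖ) ^ b * Valued.v (jE ϖ) ^ mstarOfRecord d)
    (hU : Valued.v (α - ρ α) = 1) (hτ : Valued.v (ρ α - Θ α) < 1)
    (g3 : Valued.v (lam - jE ((u : Matrix (Fin 1) (Fin 1) E) 0 0)) * Valued.v (jE ϖ ^ j) ≤
      Valued.v (α - ρ α) * Valued.v (jE ϖ) ^ b * Valued.v (jE ϖ) ^ mstarOfRecord d)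
    {n : ℕ} (hn : 3 * d - 2 + d % 2 ≤ n)
    (gsk : Valued.v (lam - jE ((u : Matrix (Fin 1) (Fin 1) E) 0 0)) *
        Valued.v ((lam - jE ((u : Matrix (Fin 1) (Fin 1) E) 0 0)) - ρ (lam - jE ((u : Matrix (Fin 1) (Fin 1) E) 0 0))) ≤
      Valued.v (jE ϖ) ^ n * Valued.v (jE ϖ ^ j * (α - ρ α)) * Valued.v (jE ϖ) ^ b)
    (hlamn : Valued.v (lam - 1) ≤ Valued.v (jE ϖ) ^ n) (hun : Valued.v ((u : Matrix (Fin 1) (Fin 1) E) 0 0 - 1) ≤ Valued.v ϖ ^ n)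
    (hμρ : ρ (lam - jE ((u : Matrix (Fin 1) (Fin 1) E) 0 0)) ≠ lam - jE ((u : Matrix (Fin 1) (Fin 1) E) 0 0))
    (Λ : AddSubgroup M) (x₀ : M)
    (hG : x₀ ≠ 0 ∧ (∀ x, x ∈ Λ ↔ ∃ ζ, IsOrd ρ α (jE ϖ ^ j) ζ ∧ x = x₀ * ζ) ∧
      IsOrd ρ α (jE ϖ ^ j) (dualGen ρ Θ α (jE ϖ ^ j) hM x₀) ∧ ¬ IsOrd ρ α (jE ϖ ^ j) (dualGen ρ Θ α (jE ϖ ^ j) hM x₀ / jE ϖ) ∧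
      Valued.v (dualGen ρ Θ α (jE ϖ ^ j) hM x₀) = Valued.v (jE ϖ) ^ b ∧
      (∀ b', (∀ x ∈ Λ, Valued.v (hM * Θ x * b' + ρ (hM * Θ x * b')) ≤ 1) → (lam - jE ((u : Matrix (Fin 1) (Fin 1) E) 0 0)) * b' ∈ Λ))
    (hfne : f b j Λ ≠ 0) :
    ((∃ B : Submodule 𝒪[E] (Fin 2 → E), B.toAddSubgroup.map φ = Λ ∧
        ∃ L₃ : Submodule 𝒪[E] (Fin 3 → E), IsSelfDualLattice σ ϖ (!![H₂ 0 0, 0, H₂ 0 1; 0, hW, 0; H₂ 1 0, 0, H₂ 1 1] : Matrix (Fin 3) (Fin 3) E) L₃ ∧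
          L₃ ⊓ LinearMap.ker ((LinearMap.proj (1 : Fin 3) : (Fin 3 → E) →ₗ[E] E).restrictScalars 𝒪[E]) =
            B.map ((Matrix.toLin' (!![1, 0; 0, 0; 0, 1] : Matrix (Fin 3) (Fin 2) E)).restrictScalars 𝒪[E]) ∧
          (∀ c : E, (Pi.single 1 c : Fin 3 → E) ∈ L₃ ↔ Valued.v c ≤ Valued.v ϖ ^ b) ∧
          {z : E | ∃ y ∈ L₃, Valued.v ((ϖ ^ (mstarOfRecord d))⁻¹ * (z - pairing σ (!![H₂ 0 0, 0, H₂ 0 1; 0, hW, 0; H₂ 1 0, 0, H₂ 1 1] : Matrix (Fin 3) (Fin 3) E) y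
              (((((endoGL (γ₂, u) : GL (Fin 3) E) : Matrix (Fin 3) (Fin 3) E) - 1)) *ᵥ y))) ≤ 1} = valueSetMod σ ϖ (mstarOfRecord d) (xPlus σ ϖ d)) ↔
      ∃ Ve : E, jE Ve = (ρ (hM * (x₀ * Θ x₀)) / (hM * (x₀ * Θ x₀) + ρ (hM * (x₀ * Θ x₀))) - κ₀) / ξ₀ ∧ Valued.v (γ₁ * (Ve - W₁)) = 1 ∧
        (Valued.v (γ₁ * (Ve - W₁)) = 1 → normSign σ (γ₁ * (Ve - W₁)) = normSign σ (-hW))) ∧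
    ((∃ B : Submodule 𝒪[E] (Fin 2 → E), B.toAddSubgroup.map φ = Λ ∧
        ∃ L₃ : Submodule 𝒪[E] (Fin 3 → E), IsSelfDualLattice σ ϖ (!![H₂ 0 0, 0, H₂ 0 1; 0, hW, 0; H₂ 1 0, 0, H₂ 1 1] : Matrix (Fin 3) (Fin 3) E) L₃ ∧
          L₃ ⊓ LinearMap.ker ((LinearMap.proj (1 : Fin 3) : (Fin 3 → E) →ₗ[E] E).restrictScalars 𝒪[E]) =
            B.map ((Matrix.toLin' (!![1, 0; 0, 0; 0, 1] : Matrix (Fin 3) (Fin 2) E)).restrictScalars 𝒪[E]) ∧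
          (∀ c : E, (Pi.single 1 c : Fin 3 → E) ∈ L₃ ↔ Valued.v c ≤ Valued.v ϖ ^ b) ∧
          ¬ {z : E | ∃ y ∈ L₃, Valued.v ((ϖ ^ (mstarOfRecord d))⁻¹ * (z - pairing σ (!![H₂ 0 0, 0, H₂ 0 1; 0, hW, 0; H₂ 1 0, 0, H₂ 1 1] : Matrix (Fin 3) (Fin 3) E) y
              (((((endoGL (γ₂, u) : GL (Fin 3) E) : Matrix (Fin 3) (Fin 3) E) - 1)) *ᵥ y))) ≤ 1} = valueSetMod σ ϖ (mstarOfRecord d) (xPlus σ ϖ d)) ↔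
      ∃ Ve : E, jE Ve = (ρ (hM * (x₀ * Θ x₀)) / (hM * (x₀ * Θ x₀) + ρ (hM * (x₀ * Θ x₀))) - κ₀) / ξ₀ ∧ Valued.v (γ₁ * (Ve - W₁)) = 1 ∧
        ¬ (Valued.v (γ₁ * (Ve - W₁)) = 1 → normSign σ (γ₁ * (Ve - W₁)) = normSign σ (-hW))) := by
  obtain ⟨hσσ, hvσ, hϖ, -, hd, hd1, -⟩ := id hD
  have hvϖ0 : Valued.v ϖ ≠ 0 := by rw [hϖ]; exact exp_ne_zero
  have hϖ0 : ϖ ≠ 0 := fun h0 => hvϖ0 (by rw [h0, map_zero])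
  have hϖlt : Valued.v ϖ < 1 := by rw [hϖ, ← exp_zero, exp_lt_exp]; norm_num
  have hϖ1 : Valued.v ϖ ≤ 1 := hϖlt.le
  have hjϖ0 : jE ϖ ≠ 0 := (map_ne_zero jE).2 hϖ0
  have hjϖv : Valued.v (jE ϖ) = Valued.v ϖ := hjiso ϖ
  have hvjϖ0 : Valued.v (jE ϖ) ≠ 0 := by rw [hjϖv]; exact hvϖ0
  have hjϖ1 : Valued.v (jE ϖ) ≤ 1 := by rw [hjϖv]; exact hϖ1
  have hjϖlt : Valued.v (jE ϖ) < 1 := by rw [hjϖv]; exact hϖlt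
  have hjv : ∀ c, Valued.v (jE c) ≤ 1 ↔ Valued.v c ≤ 1 := fun c => by rw [hjiso]
  have hρj : ∀ c : E, ρ (jE c) = jE c := fun c => (hjfix _).2 ⟨c, rfl⟩
  have hc : ρ (jE ϖ ^ j) = jE ϖ ^ j := by rw [map_pow, hρj]
  have hc0 : jE ϖ ^ j ≠ 0 := pow_ne_zero _ hjϖ0
  have hc1 : Valued.v (jE ϖ ^ j) ≤ 1 := by rw [Valuation.map_pow]; exact pow_le_one₀ zero_le hjϖ1
  have hcb : Valued.v (jE ϖ ^ j) < Valued.v (jE ϖ) ^ b := by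
    rw [Valuation.map_pow]; exact pow_lt_pow_right_of_lt_one₀ (zero_lt_iff.2 hvjϖ0) hjϖlt hbj
  have hhW1 : Valued.v (jE hW) = 1 := by rw [hjiso, hhW]
  have hsmall : Valued.v ϖ ^ (2 * d - 1) < 1 := pow_lt_one₀ zero_le hϖlt (by omega)
  have hYbpos : (0 : ℤᵐ⁰) < Valued.v (jE ϖ) ^ b := pow_pos (zero_lt_iff.2 hvjϖ0) _
  have hξpos : (0 : ℤᵐ⁰) < Valued.v ξ₀ := zero_lt_iff.2 ((Valuation.ne_zero_iff _).2 hξ0)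
  have hccApos : (0 : ℤᵐ⁰) < Valued.v (jE ϖ ^ j * (α - ρ α)) := zero_lt_iff.2 ((Valuation.ne_zero_iff _).2 hcc)
  -- `|cc(α − ρα)| ≤ |jEϖ|^j ≤ |jEϖ|^{d−1}` (`d ≤ b < j`, `|α| ≤ 1`)
  have hjd : Valued.v (jE ϖ ^ j * (α - ρ α)) ≤ Valued.v (jE ϖ) ^ (d - 1) := by
    have hA1 : Valued.v (α - ρ α) ≤ 1 := (Valuation.map_sub _ _ _).trans (max_le hα1 (by rw [hvρ]; exact hα1))
    rw [Valuation.map_mul, Valuation.map_pow]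
    exact (mul_le_of_le_one_right' hA1).trans (pow_le_pow_right_of_le_one' hjϖ1 (by omega))
  set μ : M := lam - jE ((u : Matrix (Fin 1) (Fin 1) E) 0 0) with hμdef
  set H : Matrix (Fin 3) (Fin 3) E := !![H₂ 0 0, 0, H₂ 0 1; 0, hW, 0; H₂ 1 0, 0, H₂ 1 1] with hHdef
  set tp : E := (ϖ - σ ϖ) * ((ϖ * σ ϖ) ^ ((d - d % 2) / 2))⁻¹ with htpdef
  obtain ⟨hx₀, hΛx, hyO, hyprim, hylev, hdep⟩ := hG
  have hG5 : x₀ ≠ 0 ∧ (∀ x, x ∈ Λ ↔ ∃ ζ, IsOrd ρ α (jE ϖ ^ j) ζ ∧ x = x₀ * ζ) ∧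
      IsOrd ρ α (jE ϖ ^ j) (dualGen ρ Θ α (jE ϖ ^ j) hM x₀) ∧ ¬ IsOrd ρ α (jE ϖ ^ j) (dualGen ρ Θ α (jE ϖ ^ j) hM x₀ / jE ϖ) ∧
      Valued.v (dualGen ρ Θ α (jE ϖ ^ j) hM x₀) = Valued.v (jE ϖ) ^ b := ⟨hx₀, hΛx, hyO, hyprim, hylev⟩
  have hΛmem : Λ ∈ levelSetDep ρ Θ α (jE ϖ) hM j b μ := ⟨⟨x₀, hx₀, hΛx, hyO, hyprim, hylev⟩, hdep⟩
  -- the frame of `x₀` itself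
  obtain ⟨w₀, V, hw₀Y, hσV, -, hjV, -, -, -⟩ := exists_vertexFrame_of_gen (α := α) hD jE hjiso hjfix hΘj hρρ hvρ hΘΘ hΘρ hvΘ hΘh hh hH₂σ φ hφo hform hb1 hcc
    hFgap hκ₀ hΘκ₀ hξ hΘξ hξ0 hκ₀v hR Λ x₀ hG5
  -- strict forms of the slope and root letters
  have htp0 : tp ≠ 0 := fun h00 => by
    have e := v_refSkew_eq hvσ hϖ hd
    rw [← htpdef, h00, map_zero] at e; exact pow_ne_zero _ hvϖ0 e.symm
  have hγ0 : γ₁ ≠ 0 := by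
    intro h0
    rw [h0, Valuation.map_zero, zero_mul, sub_zero] at hθ
    have hq : BE / (P * tp) = 0 := (Valuation.zero_iff _).1 (le_antisymm hθ zero_le)
    have hBE0 : BE = 0 := by rwa [div_eq_zero_iff, or_iff_left (mul_ne_zero hP0 htp0)] at hq
    have : (μ - ρ μ) * ξ₀ = 0 := by rw [← hBE, hBE0, map_zero]
    exact mul_ne_zero (sub_ne_zero.2 (Ne.symm hμρ)) hξ0 this
  have hγpos : (0 : ℤᵐ⁰) < Valued.v γ₁ := zero_lt_iff.2 ((Valuation.ne_zero_iff _).2 hγ0)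
  have hθlt : Valued.v (BE / (P * tp) - γ₁) < Valued.v γ₁ :=
    hθ.trans_lt (by
      calc Valued.v γ₁ * Valued.v ϖ ^ (2 * d - 1) < Valued.v γ₁ * 1 := mul_lt_mul_of_pos_left hsmall hγpos
        _ = Valued.v γ₁ := mul_one _)
  have hWlt : Valued.v (γ₁ * (W - W₁)) < 1 := hWW.trans_lt hsmall
  -- transfer of sphere and sign between two fixed coordinates `V′, V` with `|γ₁(V′ − V)| ≤ |ϖ|^{2d−1}`
  have htransfer : ∀ V' : E, σ V' = V' → Valued.v (γ₁ * (V' - V)) ≤ Valued.v ϖ ^ (2 * d - 1) →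
      (Valued.v (γ₁ * (V' - W₁)) = 1 ↔ Valued.v (γ₁ * (V - W₁)) = 1) ∧
      (Valued.v (γ₁ * (V - W₁)) = 1 → normSign σ (γ₁ * (V' - W₁)) = normSign σ (γ₁ * (V - W₁))) := by
    intro V' hσV' hVV
    have hVVlt : Valued.v (γ₁ * (V' - V)) < 1 := hVV.trans_lt hsmall
    have hsph : Valued.v (γ₁ * (V' - W₁)) = 1 ↔ Valued.v (γ₁ * (V - W₁)) = 1 := by
      have e1 : γ₁ * (V' - W₁) = γ₁ * (V - W₁) + γ₁ * (V' - V) := by ring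
      have e2 : γ₁ * (V - W₁) = γ₁ * (V' - W₁) - γ₁ * (V' - V) := by ring
      constructor
      · intro h1; rw [e2, Valuation.map_sub_eq_of_lt_left _ (by rw [h1]; exact hVVlt), h1]
      · intro h1; rw [e1, Valuation.map_add_eq_of_lt_left _ (by rw [h1]; exact hVVlt), h1]
    refine ⟨hsph, fun h1 => ?_⟩
    have hσg : σ (γ₁ * (V - W₁)) = γ₁ * (V - W₁) := by rw [map_mul, map_sub, hσγ, hσV, hσW₁]
    have hσg' : σ (γ₁ * (V' - W₁)) = γ₁ * (V' - W₁) := by rw [map_mul, map_sub, hσγ, hσV', hσW₁]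
    refine normSign_eq_of_near hD hσg hσg' h1 (n := 2 * d - 1) le_rfl ?_
    have e : γ₁ * (V - W₁) - γ₁ * (V' - W₁) = -(γ₁ * (V' - V)) := by ring
    rw [e, Valuation.map_neg]; exact hVV
  -- KEY: for ANY glued vertex over `Λ`, the sphere digit holds at `V` and the label reads through the sign at `V`
  have key : ∀ (B : Submodule 𝒪[E] (Fin 2 → E)) (L₃ : Submodule 𝒪[E] (Fin 3 → E)), B.toAddSubgroup.map φ = Λ → IsSelfDualLattice σ ϖ H L₃ →
      L₃ ⊓ LinearMap.ker ((LinearMap.proj (1 : Fin 3) : (Fin 3 → E) →ₗ[E] E).restrictScalars 𝒪[E]) =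
        B.map ((Matrix.toLin' (!![1, 0; 0, 0; 0, 1] : Matrix (Fin 3) (Fin 2) E)).restrictScalars 𝒪[E]) →
      (∀ c : E, (Pi.single 1 c : Fin 3 → E) ∈ L₃ ↔ Valued.v c ≤ Valued.v ϖ ^ b) →
      Valued.v (γ₁ * (V - W₁)) = 1 ∧
      ({z : E | ∃ y ∈ L₃, Valued.v ((ϖ ^ (mstarOfRecord d))⁻¹ * (z - pairing σ H y (((((endoGL (γ₂, u) : GL (Fin 3) E) : Matrix (Fin 3) (Fin 3) E) - 1)) *ᵥ y))) ≤ 1} =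
          valueSetMod σ ϖ (mstarOfRecord d) (xPlus σ ϖ d) ↔ normSign σ (γ₁ * (V - W₁)) = normSign σ (-hW)) := by
    intro B L₃ hBΛ hSD hLB htube
    obtain ⟨x₁, w₁, g₁, hx₁, hΛx₁, hyO₁, hyp₁, hylev₁, hw₁Y, hpr, hg₁, hg₁1, hprg⟩ :=
      exists_presentation_of_mem_levelSetDep σ hσσ hvσ hϖ hH₂ hH₂σ hhW jE hρρ hvρ hα hα1 hint hΘΘ hΘρ hvΘ hjv hjfix hjpow hϖmax φ hφs hφi hφo hφγ hvlam
        hΘh hh hform ((u : Matrix (Fin 1) (Fin 1) E) 0 0) hb1 hlamj hΛmem hBΛ hSD hLB htube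
    have hG5₁ : x₁ ≠ 0 ∧ (∀ x, x ∈ Λ ↔ ∃ ζ, IsOrd ρ α (jE ϖ ^ j) ζ ∧ x = x₁ * ζ) ∧
        IsOrd ρ α (jE ϖ ^ j) (dualGen ρ Θ α (jE ϖ ^ j) hM x₁) ∧ ¬ IsOrd ρ α (jE ϖ ^ j) (dualGen ρ Θ α (jE ϖ ^ j) hM x₁ / jE ϖ) ∧
        Valued.v (dualGen ρ Θ α (jE ϖ ^ j) hM x₁) = Valued.v (jE ϖ) ^ b := ⟨hx₁, hΛx₁, hyO₁, hyp₁, hylev₁⟩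
    -- the frame at the presentation generator `x₁` (its plane vector is `w₁`, by injectivity of `φ`)
    obtain ⟨w₁', V₁, hw₁'Y, hσV₁, -, hjV₁, hκ₁, hσpw₁, hpwP₁⟩ := exists_vertexFrame_of_gen (α := α) hD jE hjiso hjfix hΘj hρρ hvρ hΘΘ hΘρ hvΘ hΘh hh hH₂σ φ
      hφo hform hb1 hcc hFgap hκ₀ hΘκ₀ hξ hΘξ hξ0 hκ₀v hR Λ x₁ hG5₁
    have hww : w₁' = w₁ := hφi (by rw [hw₁'Y, hw₁Y])
    subst hww
    -- SHARP generator independence (★ p864599): `|γ₁(V₁ − V)| ≤ |γ₁|·|ϖ|^{2b+d−1}∕(|ξ₀|·|cc(α − ρα)|) ≤ |ϖ|^{2d−1}`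
    have hnear : Valued.v (γ₁ * (V₁ - V)) ≤ Valued.v ϖ ^ (2 * d - 1) := by
      have hmul := v_coord_sub_coord_mul_le_sharpA_of_gen jE hjfix hjϖ0 hjϖ1 hρρ hvρ hΘΘ hΘρ hDMρ hΘh hb1 hcc hFgap κ₀ hξ0 Λ x₀ x₁ hG5 hG5₁
      rw [← hjV₁, ← hjV, ← map_sub, hjiso, max_eq_left hjd, ← pow_add, hjϖv, show 2 * b + (d - 1) = 2 * b + d - 1 by omega] at hmul
      refine le_of_mul_le_mul_right ?_ (mul_pos hξpos hccApos)
      rw [Valuation.map_mul]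
      calc Valued.v γ₁ * Valued.v (V₁ - V) * (Valued.v ξ₀ * Valued.v (jE ϖ ^ j * (α - ρ α)))
          = Valued.v γ₁ * (Valued.v (V₁ - V) * Valued.v ξ₀ * Valued.v (jE ϖ ^ j * (α - ρ α))) := by ac_rfl
        _ ≤ Valued.v γ₁ * Valued.v ϖ ^ (2 * b + d - 1) := mul_le_mul' le_rfl hmul
        _ ≤ Valued.v ϖ ^ (2 * d - 1) * (Valued.v ξ₀ * Valued.v (jE ϖ ^ j * (α - ρ α))) := hγr
    obtain ⟨hsphT, hsignT⟩ := htransfer V₁ hσV₁ hnear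
    have hY₁0 : dualGen ρ Θ α (jE ϖ ^ j) hM x₁ ≠ 0 := fun h0 => by
      rw [h0, map_zero] at hylev₁; exact (pow_ne_zero _ hvjϖ0) hylev₁.symm
    have hpwP₁' : Valued.v (pairing σ H₂ w₁' w₁' * P) = 1 := by rw [hPb]; exact hpwP₁
    -- the ray scalar of the vertex at `x₁` (a `ρ`-fixed trace), for ★ p864441 §1
    obtain ⟨e₁, he₁⟩ : ∃ e₁ : E, jE e₁ = μ / (jE ϖ ^ j * (α - ρ α) * Θ (dualGen ρ Θ α (jE ϖ ^ j) hM x₁)) +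
        ρ (μ / (jE ϖ ^ j * (α - ρ α) * Θ (dualGen ρ Θ α (jE ϖ ^ j) hM x₁))) := (hjfix _).1 (by rw [map_add, hρρ, add_comm])
    -- the sphere at `x₁` is AUTOMATIC on the lower line (★ p864441 §1), then transfer to `V`
    have hsph₁ : Valued.v (γ₁ * (V₁ - W₁)) = 1 :=
      sphere_of_line hvσ hϖ hd H₂ jE hjv hjfix hρρ hvρ hα hα1 hΘΘ hΘρ hvΘ φ hh hform hc hc0 hcc hx₁ hw₁Y hyO₁ hylev₁ hcb hμle hanti he₁ hμρ hκ₁ hWc hBE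
        hP0 hpwP₁' hθlt hWlt
    have hsph : Valued.v (γ₁ * (V - W₁)) = 1 := hsphT.1 hsph₁
    refine ⟨hsph, ?_⟩
    -- the label at `x₁` (★ p864441 §2): integral pairing on `L₃` from self-duality
    have hintL : ∀ y ∈ L₃, Valued.v (pairing σ H y y) ≤ 1 := fun y hy =>
      (mem_dualLatt σ H L₃ y).1 (le_dualLatt_of_isVertexLattice hvσ hSD hy) y hy
    have hVS := valueSet_eq_xPlus_iff_sphereSign_of_line_A (α := α) hD H₂ hW jE hjv hjiso hjfix hρρ hvρ hα hα1 hΘΘ hΘρ hvΘ hΘj φ hφs hφγ hh hΘh hform hpr hintL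
      hLB.symm hg₁ hg₁1 hprg u hc hc0 hc1 hcc hx₁ hBΛ hΛx₁ hw₁Y hyO₁ hylev₁ hcb hμle hanti g1 g2b g2c hU hτ h2v g3 hn gsk hΘlam hvlam huu hlamn hun hμρ hσV₁ hκ₁ hWc
      hBE hP0
      hσP hσpw₁ hpwP₁' hσγ hσW₁ hθ hWW
    -- the population sign at `x₁` (★ R1b-A §3)
    have hs₁ : normSign σ (pairing σ H₂ w₁' w₁' * P) = normSign σ (-hW) := by
      rw [hPb]
      exact (weight_ne_zero_iff_normSign_of_gen6 hD h2v jE hjv hjfix hΘj hρρ hvρ hΘΘ hΘρ hvΘ hΘh hh φ hform hb1 hdb hcc hFgap hhWσ hhW1 hlamj f hf Λ x₁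
        ⟨hx₁, hΛx₁, hyO₁, hyp₁, hylev₁, hdep⟩ hw₁Y).1 hfne
    rw [hVS, normSign_mul_eq_one_iff_eq hs₁, hsignT hsph]
  -- `jE` is injective: the coordinate is pinned
  have hVf : ∀ Ve : E, jE Ve = (ρ (hM * (x₀ * Θ x₀)) / (hM * (x₀ * Θ x₀) + ρ (hM * (x₀ * Θ x₀))) - κ₀) / ξ₀ → Ve = V :=
    fun Ve h1 => jE.injective (h1.trans hjV.symm)
  refine ⟨⟨?_, ?_⟩, ⟨?_, ?_⟩⟩
  · rintro ⟨B, hBΛ, L₃, hSD, hLB, htube, hVSa⟩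
    obtain ⟨hNX, hsgi⟩ := key B L₃ hBΛ hSD hLB htube
    exact ⟨V, hjV, hNX, fun _ => hsgi.1 hVSa⟩
  · rintro ⟨Ve, hjVe, hNX, hψ⟩
    have hVe := hVf Ve hjVe
    subst Ve
    obtain ⟨B, hBΛ, L₃, hSD, hLB, htube⟩ := exists_glued_of_mem_levelSetDep_of_weight_ne_zero σ hσσ hvσ hϖ hH₂ hH₂σ hhW hhWσ jE hρρ hvρ hα hα1 hint hΘΘ hΘρ
      hvΘ hΘj hjv hjfix hjpow hϖmax φ hφs hφi hφo hφγ hvlam hΘh hh hform ((u : Matrix (Fin 1) (Fin 1) E) 0 0) hb1 hlamj f hf hΛmem hfne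
    obtain ⟨-, hsgi⟩ := key B L₃ hBΛ hSD hLB htube
    exact ⟨B, hBΛ, L₃, hSD, hLB, htube, hsgi.2 (hψ hNX)⟩
  · rintro ⟨B, hBΛ, L₃, hSD, hLB, htube, hVSa⟩
    obtain ⟨hNX, hsgi⟩ := key B L₃ hBΛ hSD hLB htube
    exact ⟨V, hjV, hNX, fun hψ => hVSa (hsgi.2 (hψ hNX))⟩
  · rintro ⟨Ve, hjVe, hNX, hψ⟩
    have hVe := hVf Ve hjVe
    subst Ve
    obtain ⟨B, hBΛ, L₃, hSD, hLB, htube⟩ := exists_glued_of_mem_levelSetDep_of_weight_ne_zero σ hσσ hvσ hϖ hH₂ hH₂σ hhW hhWσ jE hρρ hvρ hα hα1 hint hΘΘ hΘρ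
      hvΘ hΘj hjv hjfix hjpow hϖmax φ hφs hφi hφo hφγ hvlam hΘh hh hform ((u : Matrix (Fin 1) (Fin 1) E) 0 0) hb1 hlamj f hf hΛmem hfne
    obtain ⟨-, hsgi⟩ := key B L₃ hBΛ hSD hLB htube
    exact ⟨B, hBΛ, L₃, hSD, hLB, htube, fun hVSa => hψ fun _ => hsgi.1 hVSa⟩

end Summit.HodgeConjecture.HodgeConjecture.Cruxes.H413.F0P3cDyRamLowerLineCellLiteralReadsA

end
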